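import Summits.AtomisticToContinuum.FouriersLaw.Theses.OddSectorIrreversibility
import Summits.AtomisticToContinuum.FouriersLaw.Theorems.OddResponseBound.Negative.OddPairing
import Summits.AtomisticToContinuum.FouriersLaw.Theorems.OddSectorIrreversibilityConeScaleCorrectorStubHorizonCorrectorMemLp
import Summits.AtomisticToContinuum.FouriersLaw.Theorems.OddSectorIrreversibilityConeScaleCorrectorStubMinkowskiInTime
import Summits.AtomisticToContinuum.FouriersLaw.Theorems.OddSectorIrreversibilityConeScaleCorrectorStubConeTransportBudget
import Literature.MathematicalPhysics.KineticTheory.LangevinChainKernel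
import Literature.MathematicalPhysics.KineticTheory.OddSectorLocalityHypothesis

/-!
# `ConeScaleCorrector` (E1) — skeleton of line `GlueInnerCone` (card inner-cone-minkowski-tail)

Crux item stmt-AtomisticToContinuum-14069, route decl
`Summit.AtomisticToContinuum.FouriersLaw.Theses.OddSectorIrreversibility.ConeScaleCorrector`.
Lead prover-line-stmt-AtomisticToContinuum-14069-a1-0 (re-seat a1). The composition is the ideator's
`GlueIdeator1InnerCone.lean` (`innerConeGlue_holds`, kernel-checked), reshaped so that the crossing
parameter `a` may depend on the parameter point and the stubs are stated on the Literature curve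
`OddSectorLocality.forecastNormSq` / `currentForecast` / `gibbsWeight`.

Registered stubs (sorries ONLY here):
* `stub_coneTransportBudget` (C1, N-uniform): `∫ u_τ² dμ_T ≤ C·N·(1+τ)·Z` for every horizon `τ ≥ 0`.
* `stub_postCrossingMinkowskiTail` (FD2, N-uniform, hardest): `∃ a C, ∀ N, ∫_{(aN,∞)} √A_N(t) dt ≤ C·N·√Z`
  (with the `IntegrableOn` conjunct keeping the Bochner integral honest), `A_N(t) = ‖P_tJ‖²_{L²(μ_T)}`.
* `stub_minkowskiInTime` (fixed N, bookkeeping) — CLOSED, LANDED p97789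
  (`Theorems/OddSectorIrreversibilityConeScaleCorrectorStubMinkowskiInTime.lean`):
  `‖u_S − u_A‖_{L²(μ_T)} ≤ ∫_{(A,S]} √A_N(t) dt` for `0 ≤ A ≤ S` whenever the right side is an honest
  integral (it always is: `integrableOn_sqrt_forecastNormSq`, p99594).
Honest partial results on the two N-uniform stubs (landed, `--supports`): C1 holds with `K·N·τ²·Z`
(`exists_const_integral_sq_horizonCorrector_le`, p100798: contraction `A_N ≤ M_N` p99594 + statics
`M_N ≤ K N Z`) and on bounded horizons (`coneTransportBudget_of_le`); FD2 holds at every fixed `N` with an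
`N`-dependent constant (`stub_postCrossingMinkowskiTail_fixedN`, p102607).
The `MemLp` half of the card's bookkeeping is the LANDED `stub_horizonCorrectorMemLp` (p91238), imported.
Composition: `ConeScaleCorrector_of` — for `S ≤ aN` the budget C1; for `S ≥ aN` Minkowski in `L²(μ_T)`
(`u_S = u_{aN} + (u_S − u_{aN})`) and the Minkowski-in-time tail; hence `∫ u_S² ≤ K N² Z` for every
horizon; then Fatou along the crux's a.e.-limit predicate through integer horizons.
-/

noncomputable section

open MeasureTheory Filter Set Topology
open scoped BigOperators ENNReal NNReal
open Literature.MathematicalPhysics.KineticTheory.HeatConduction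
open Literature.MathematicalPhysics.KineticTheory
open Literature.MathematicalPhysics.KineticTheory.OddSectorLocality
open Summit.AtomisticToContinuum.FouriersLaw.Theorems.OddResponseBound.Negative.OddPairing

namespace Summit.AtomisticToContinuum.FouriersLaw.Theorems.OddSectorIrreversibility.InnerCone

/-! ## Registered stubs -/

/-- **C1 · `stub_coneTransportBudget`** (N-uniform; Einstein–Helfand budget of the finite-horizon
corrector of the OPEN chain at every horizon): `∫ (∫_{(0,τ]} P_tJ_tot dt)² dμ_T ≤ C·N·(1+τ)·Z`. -/
theorem stub_coneTransportBudget :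
    ∀ ω₂ lam β γ : ℝ, 0 < ω₂ → 0 < lam → 0 < β → 0 < γ → ∀ T : ℝ, 0 < T → ∃ C : ℝ, ∀ (N : ℕ) (τ : ℝ),
      0 ≤ τ →
      ∫ x, (∫ t in Set.Ioc (0 : ℝ) τ,
          Literature.MathematicalPhysics.KineticTheory.OddSectorLocality.currentForecast ω₂ lam β γ T N t x) ^ 2
        ∂(Literature.MathematicalPhysics.KineticTheory.OddSectorLocality.gibbsWeight ω₂ lam β γ T N) ≤
      C * (N : ℝ) * (1 + τ) *
        ∫ x, Real.exp (-((Literature.MathematicalPhysics.KineticTheory.HeatConduction.pinnedChain ω₂ lam β γ).hamiltonian N x) / T)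
          ∂MeasureTheory.volume := by
  sorry

/-- **FD2 · `stub_postCrossingMinkowskiTail`** (N-uniform, hardest; time-gated Minkowski tail): after
`a` time units per site the `L²(μ_T)`-norm of the total-current forecast is integrable in time with
budget `C·N·√Z`: `∫_{(aN,∞)} √A_N(t) dt ≤ C·N·√Z`, `A_N = forecastNormSq`. -/
theorem stub_postCrossingMinkowskiTail :
    ∀ ω₂ lam β γ : ℝ, 0 < ω₂ → 0 < lam → 0 < β → 0 < γ → ∀ T : ℝ, 0 < T → ∃ a C : ℝ, 0 < a ∧ ∀ N : ℕ,
      MeasureTheory.IntegrableOn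
          (fun t : ℝ => Real.sqrt (Literature.MathematicalPhysics.KineticTheory.OddSectorLocality.forecastNormSq ω₂ lam β γ T N t))
          (Set.Ioi (a * (N : ℝ))) ∧
        ∫ t in Set.Ioi (a * (N : ℝ)),
            Real.sqrt (Literature.MathematicalPhysics.KineticTheory.OddSectorLocality.forecastNormSq ω₂ lam β γ T N t) ≤
          C * (N : ℝ) * Real.sqrt (∫ x,
            Real.exp (-((Literature.MathematicalPhysics.KineticTheory.HeatConduction.pinnedChain ω₂ lam β γ).hamiltonian N x) / T)
              ∂MeasureTheory.volume) := by
  sorry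

/-- **`stub_minkowskiInTime`** (fixed N, bookkeeping; Minkowski's integral inequality for the forecast
curve `t ↦ P_tJ_tot` in `L²(μ_T)`): for `0 ≤ A ≤ S`, if `t ↦ √A_N(t)` is integrable on `(A,S]` then
`√(∫ (u_S − u_A)² dμ_T) ≤ ∫_{(A,S]} √A_N(t) dt`, `u_S = ∫_{(0,S]} P_tJ_tot dt`.
CLOSED — LANDED p97789 (worker of this lead; duality proof via `sqrt_integral_sq_integral_le`). -/
theorem stub_minkowskiInTime :
    ∀ ω₂ lam β γ : ℝ, 0 < ω₂ → 0 < lam → 0 < β → 0 < γ → ∀ T : ℝ, 0 < T → ∀ (N : ℕ) (A S : ℝ),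
      0 ≤ A → A ≤ S →
      MeasureTheory.IntegrableOn
          (fun t : ℝ => Real.sqrt (Literature.MathematicalPhysics.KineticTheory.OddSectorLocality.forecastNormSq ω₂ lam β γ T N t))
          (Set.Ioc A S) →
      Real.sqrt (∫ x, ((∫ t in Set.Ioc (0 : ℝ) S,
            Literature.MathematicalPhysics.KineticTheory.OddSectorLocality.currentForecast ω₂ lam β γ T N t x) -
          ∫ t in Set.Ioc (0 : ℝ) A,
            Literature.MathematicalPhysics.KineticTheory.OddSectorLocality.currentForecast ω₂ lam β γ T N t x) ^ 2
        ∂(Literature.MathematicalPhysics.KineticTheory.OddSectorLocality.gibbsWeight ω₂ lam β γ T N)) ≤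
      ∫ t in Set.Ioc A S,
        Real.sqrt (Literature.MathematicalPhysics.KineticTheory.OddSectorLocality.forecastNormSq ω₂ lam β γ T N t) :=
  Summit.AtomisticToContinuum.FouriersLaw.Theorems.OddSectorIrreversibility.stub_minkowskiInTime

/-! ## Vocabulary of the composition (the ideator's abbreviations; `rfl`-bridged to the stubs) -/

/-- Unnormalised Gibbs weight `e^{−H_N/T} dq dp`. -/
def gibbsW (P : OscillatorChain) (N : ℕ) (T : ℝ) : Measure (PhaseSpace N) :=
  volume.withDensity (fun x : PhaseSpace N => ENNReal.ofReal (Real.exp (-(P.hamiltonian N x) / T)))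

/-- Its mass `Z`. -/
def gibbsZ (P : OscillatorChain) (N : ℕ) (T : ℝ) : ℝ :=
  ∫ x, Real.exp (-(P.hamiltonian N x) / T) ∂(volume : Measure (PhaseSpace N))

/-- Total current `J = Σ_i j_i`. -/
def Jtot (P : OscillatorChain) (N : ℕ) (z : PhaseSpace N) : ℝ := ∑ i : Fin N, P.bondCurrent N i z

/-- Forecast `(P_t f)(x)`. -/
def fcast (P : OscillatorChain) (N : ℕ) (T : ℝ) (f : PhaseSpace N → ℝ) (t : ℝ) (x : PhaseSpace N) : ℝ :=
  ∫ y, f y ∂(P.transitionKernel N T T t.toNNReal x)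

/-- Finite-horizon Kubo forecast `u^f_S(x) = ∫₀^S (P_t f)(x) dt`. -/
def forecast (P : OscillatorChain) (N : ℕ) (T : ℝ) (f : PhaseSpace N → ℝ) (S : ℝ)
    (x : PhaseSpace N) : ℝ :=
  ∫ t in Set.Ioc (0 : ℝ) S, fcast P N T f t x

/-- The crux's corrector predicate. -/
def IsCorrectorLimit (P : OscillatorChain) (N : ℕ) (T : ℝ) (u : PhaseSpace N → ℝ) : Prop :=
  ∀ᵐ x ∂(gibbsW P N T), Tendsto (fun τ : ℝ => forecast P N T (Jtot P N) τ x) atTop (𝓝 (u x))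

/-- E1 written with `gibbsW / gibbsZ / forecast / Jtot`. -/
def CruxClean : Prop :=
  ∀ ω₂ lam β γ : ℝ, 0 < ω₂ → 0 < lam → 0 < β → 0 < γ → ∀ T : ℝ, 0 < T → ∃ C : ℝ,
    ∀ (N : ℕ) (u : PhaseSpace N → ℝ), IsCorrectorLimit (pinnedChain ω₂ lam β γ) N T u →
      MemLp u 2 (gibbsW (pinnedChain ω₂ lam β γ) N T) ∧
        ∫ x, (u x) ^ 2 ∂(gibbsW (pinnedChain ω₂ lam β γ) N T) ≤
          C * (N : ℝ) ^ 2 * gibbsZ (pinnedChain ω₂ lam β γ) N T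

/-- PROBE: the route decl is, verbatim up to the abbreviations above, `CruxClean`. -/
theorem coneScaleCorrector_iff_clean :
    Summit.AtomisticToContinuum.FouriersLaw.Theses.OddSectorIrreversibility.ConeScaleCorrector ↔
      CruxClean :=
  Iff.rfl

/-- C1 at one parameter point, in the composition's vocabulary. -/
def BudgetAt (ω₂ lam β γ T : ℝ) : Prop :=
  ∃ C : ℝ, ∀ N : ℕ, ∀ τ : ℝ, 0 ≤ τ →
    let P := pinnedChain ω₂ lam β γ
    ∫ x, (forecast P N T (Jtot P N) τ x) ^ 2 ∂(gibbsW P N T) ≤ C * (N : ℝ) * (1 + τ) * gibbsZ P N T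

/-- FD2 at one parameter point and crossing parameter `a`. -/
def TailAt (a ω₂ lam β γ T : ℝ) : Prop :=
  ∃ C : ℝ, ∀ N : ℕ,
    IntegrableOn (fun t : ℝ => Real.sqrt (forecastNormSq ω₂ lam β γ T N t)) (Set.Ioi (a * (N : ℝ))) ∧
      ∫ t in Set.Ioi (a * (N : ℝ)), Real.sqrt (forecastNormSq ω₂ lam β γ T N t) ≤
        C * (N : ℝ) * Real.sqrt (gibbsZ (pinnedChain ω₂ lam β γ) N T)

/-- Fixed-N bookkeeping at one parameter point and crossing parameter `a`. -/
def BookAt (a ω₂ lam β γ T : ℝ) : Prop :=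
  ∀ N : ℕ, ∀ S : ℝ, 0 ≤ S →
    let P := pinnedChain ω₂ lam β γ
    MemLp (forecast P N T (Jtot P N) S) 2 (gibbsW P N T) ∧
      (a * (N : ℝ) ≤ S →
        IntegrableOn (fun t : ℝ => Real.sqrt (forecastNormSq ω₂ lam β γ T N t)) (Set.Ioc (a * (N : ℝ)) S) →
          Real.sqrt (∫ x, (forecast P N T (Jtot P N) S x - forecast P N T (Jtot P N) (a * N) x) ^ 2
              ∂(gibbsW P N T)) ≤
            ∫ t in Set.Ioc (a * (N : ℝ)) S, Real.sqrt (forecastNormSq ω₂ lam β γ T N t))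

/-- The conclusion of E1 at one parameter point. -/
def CruxAt (ω₂ lam β γ T : ℝ) : Prop :=
  ∃ C : ℝ, ∀ (N : ℕ) (u : PhaseSpace N → ℝ), IsCorrectorLimit (pinnedChain ω₂ lam β γ) N T u →
    MemLp u 2 (gibbsW (pinnedChain ω₂ lam β γ) N T) ∧
      ∫ x, (u x) ^ 2 ∂(gibbsW (pinnedChain ω₂ lam β γ) N T) ≤
        C * (N : ℝ) ^ 2 * gibbsZ (pinnedChain ω₂ lam β γ) N T

/-! ## Bridges from the stubs (definitional) -/

theorem budgetAt_of_stub {ω₂ lam β γ T : ℝ} (hω : 0 < ω₂) (hl : 0 < lam) (hβ : 0 < β) (hγ : 0 < γ)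
    (hT : 0 < T) : BudgetAt ω₂ lam β γ T :=
  stub_coneTransportBudget ω₂ lam β γ hω hl hβ hγ T hT

theorem tailAt_of_stub {ω₂ lam β γ T : ℝ} (hω : 0 < ω₂) (hl : 0 < lam) (hβ : 0 < β) (hγ : 0 < γ)
    (hT : 0 < T) : ∃ a : ℝ, 0 < a ∧ TailAt a ω₂ lam β γ T := by
  obtain ⟨a, C, ha, h⟩ := stub_postCrossingMinkowskiTail ω₂ lam β γ hω hl hβ hγ T hT
  exact ⟨a, ha, C, h⟩

theorem bookAt_of_stub {ω₂ lam β γ T : ℝ} (hω : 0 < ω₂) (hl : 0 < lam) (hβ : 0 < β) (hγ : 0 < γ)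
    (hT : 0 < T) {a : ℝ} (ha : 0 < a) : BookAt a ω₂ lam β γ T := by
  intro N S hS
  refine ⟨stub_horizonCorrectorMemLp ω₂ lam β γ hω hl hβ hγ T hT N S hS, fun haS hint => ?_⟩
  exact stub_minkowskiInTime ω₂ lam β γ hω hl hβ hγ T hT N (a * N) S
    (mul_nonneg ha.le (Nat.cast_nonneg N)) haS hint

/-! ## Minkowski in `L²` for real functions (plain integrals) -/

theorem sqrt_integral_add_sq_le {X : Type*} [MeasurableSpace X] {μ : Measure X} {f g : X → ℝ}
    (hf : MemLp f 2 μ) (hg : MemLp g 2 μ) :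
    Real.sqrt (∫ x, (f x + g x) ^ 2 ∂μ) ≤
      Real.sqrt (∫ x, f x ^ 2 ∂μ) + Real.sqrt (∫ x, g x ^ 2 ∂μ) := by
  set A := ∫ x, f x ^ 2 ∂μ with hA_def
  set B := ∫ x, g x ^ 2 ∂μ with hB_def
  have hA : 0 ≤ A := integral_nonneg fun _ => sq_nonneg _
  have hB : 0 ≤ B := integral_nonneg fun _ => sq_nonneg _
  have hCS : (∫ x, f x * g x ∂μ) ^ 2 ≤ A * B := sq_integral_mul_le hf hg
  have hfg : ∫ x, f x * g x ∂μ ≤ Real.sqrt A * Real.sqrt B := by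
    have h1 : |∫ x, f x * g x ∂μ| ≤ Real.sqrt (A * B) := by
      rw [← Real.sqrt_sq_eq_abs]
      exact Real.sqrt_le_sqrt hCS
    rw [Real.sqrt_mul hA] at h1
    exact le_trans (le_abs_self _) h1
  have hf2 : Integrable (fun x => f x ^ 2) μ := hf.integrable_sq
  have hg2 : Integrable (fun x => g x ^ 2) μ := hg.integrable_sq
  have hfg' : Integrable (fun x => f x * g x) μ := hf.integrable_mul hg
  have h2fg : Integrable (fun x => 2 * (f x * g x)) μ := hfg'.const_mul 2
  have h12 : Integrable (fun x => f x ^ 2 + 2 * (f x * g x)) μ := hf2.add h2fg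
  have hsum : ∫ x, (f x + g x) ^ 2 ∂μ = A + 2 * ∫ x, f x * g x ∂μ + B := by
    have e1 : ∫ x, (f x + g x) ^ 2 ∂μ = ∫ x, (f x ^ 2 + 2 * (f x * g x)) + g x ^ 2 ∂μ := by
      congr 1; funext x; ring
    have e2 : ∫ x, (f x ^ 2 + 2 * (f x * g x)) + g x ^ 2 ∂μ =
        (∫ x, f x ^ 2 + 2 * (f x * g x) ∂μ) + ∫ x, g x ^ 2 ∂μ := integral_add h12 hg2
    have e3 : ∫ x, f x ^ 2 + 2 * (f x * g x) ∂μ = (∫ x, f x ^ 2 ∂μ) + ∫ x, 2 * (f x * g x) ∂μ :=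
      integral_add hf2 h2fg
    have e4 : ∫ x, 2 * (f x * g x) ∂μ = 2 * ∫ x, f x * g x ∂μ := integral_const_mul 2 _
    rw [e1, e2, e3, e4]
  have hle : ∫ x, (f x + g x) ^ 2 ∂μ ≤ (Real.sqrt A + Real.sqrt B) ^ 2 := by
    rw [hsum, add_sq, Real.sq_sqrt hA, Real.sq_sqrt hB]
    nlinarith [hfg]
  calc Real.sqrt (∫ x, (f x + g x) ^ 2 ∂μ)
      ≤ Real.sqrt ((Real.sqrt A + Real.sqrt B) ^ 2) := Real.sqrt_le_sqrt hle
    _ = Real.sqrt A + Real.sqrt B :=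
        Real.sqrt_sq (add_nonneg (Real.sqrt_nonneg _) (Real.sqrt_nonneg _))


/-! ## The composition at one parameter point (the ideator's proved glue, `a` now local) -/

/-- **Inner-cone glue at a parameter point**: C1, FD2 at some `a > 0`, and the bookkeeping at that `a`
give the conclusion of E1 with `C = (√(C₁⁺(1+a)) + C₂⁺)²`. Fixed-N bookkeeping only. -/
theorem cruxAt_of {ω₂ lam β γ T a : ℝ} (ha : 0 < a) (hB : BudgetAt ω₂ lam β γ T)
    (hT : TailAt a ω₂ lam β γ T) (hKK : BookAt a ω₂ lam β γ T) : CruxAt ω₂ lam β γ T := by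
  obtain ⟨C₁, hC₁⟩ := hB
  obtain ⟨C₂, hC₂⟩ := hT
  -- constants
  have hC₁' : C₁ ≤ max C₁ 0 := le_max_left _ _
  have hC₁'0 : 0 ≤ max C₁ 0 := le_max_right _ _
  have hC₂' : C₂ ≤ max C₂ 0 := le_max_left _ _
  have hC₂'0 : 0 ≤ max C₂ 0 := le_max_right _ _
  have hD0 : 0 ≤ max C₁ 0 * (1 + a) := mul_nonneg hC₁'0 (by linarith)
  refine ⟨(Real.sqrt (max C₁ 0 * (1 + a)) + max C₂ 0) ^ 2, fun N u hu => ?_⟩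
  have hKnonneg : 0 ≤ (Real.sqrt (max C₁ 0 * (1 + a)) + max C₂ 0) ^ 2 := sq_nonneg _
  have hDK : max C₁ 0 * (1 + a) ≤ (Real.sqrt (max C₁ 0 * (1 + a)) + max C₂ 0) ^ 2 := by
    have h1 : Real.sqrt (max C₁ 0 * (1 + a)) ^ 2 = max C₁ 0 * (1 + a) := Real.sq_sqrt hD0
    nlinarith [Real.sqrt_nonneg (max C₁ 0 * (1 + a)), h1]
  -- abbreviations (no `set`, to keep defeq transparent)
  have hZ0 : 0 ≤ gibbsZ (pinnedChain ω₂ lam β γ) N T := integral_nonneg fun _ => (Real.exp_pos _).le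
  have hN0 : (0 : ℝ) ≤ N := Nat.cast_nonneg N
  have hNN : (N : ℝ) ≤ (N : ℝ) ^ 2 := by
    have : (N : ℝ) * 1 ≤ (N : ℝ) * N := by
      rcases Nat.eq_zero_or_pos N with h0 | hpos
      · simp [h0]
      · exact mul_le_mul_of_nonneg_left (by exact_mod_cast hpos) hN0
    nlinarith [this]
  -- MemLp of the explicit forecasts (bookkeeping)
  have hmem : ∀ S : ℝ, 0 ≤ S →
      MemLp (forecast (pinnedChain ω₂ lam β γ) N T (Jtot (pinnedChain ω₂ lam β γ) N) S) 2
        (gibbsW (pinnedChain ω₂ lam β γ) N T) := fun S hS => (hKK N S hS).1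
  -- budget up to the crossing, in the form  ∫ u_S² ≤ (max C₁ 0)(1+a) N² Z
  have hbudget : ∀ S : ℝ, 0 ≤ S → S ≤ a * N →
      ∫ x, (forecast (pinnedChain ω₂ lam β γ) N T (Jtot (pinnedChain ω₂ lam β γ) N) S x) ^ 2
          ∂(gibbsW (pinnedChain ω₂ lam β γ) N T) ≤
        max C₁ 0 * (1 + a) * (N : ℝ) ^ 2 * gibbsZ (pinnedChain ω₂ lam β γ) N T := by
    intro S hS hSa
    have h1 : ∫ x, (forecast (pinnedChain ω₂ lam β γ) N T (Jtot (pinnedChain ω₂ lam β γ) N) S x) ^ 2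
          ∂(gibbsW (pinnedChain ω₂ lam β γ) N T) ≤
        C₁ * (N : ℝ) * (1 + S) * gibbsZ (pinnedChain ω₂ lam β γ) N T := hC₁ N S hS
    have h2 : C₁ * (N : ℝ) * (1 + S) * gibbsZ (pinnedChain ω₂ lam β γ) N T ≤
        max C₁ 0 * (N : ℝ) * (1 + S) * gibbsZ (pinnedChain ω₂ lam β γ) N T := by
      have : 0 ≤ (N : ℝ) * (1 + S) * gibbsZ (pinnedChain ω₂ lam β γ) N T := by positivity
      nlinarith [hC₁', this]
    have h3 : max C₁ 0 * (N : ℝ) * (1 + S) * gibbsZ (pinnedChain ω₂ lam β γ) N T ≤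
        max C₁ 0 * (1 + a) * (N : ℝ) ^ 2 * gibbsZ (pinnedChain ω₂ lam β γ) N T := by
      have h4 : (N : ℝ) * (1 + S) ≤ (1 + a) * (N : ℝ) ^ 2 := by
        have h5 : (N : ℝ) * S ≤ (N : ℝ) * (a * N) := mul_le_mul_of_nonneg_left hSa hN0
        nlinarith [h5, hNN, ha, hN0]
      have := mul_le_mul_of_nonneg_left h4 hC₁'0
      have := mul_le_mul_of_nonneg_right this hZ0
      nlinarith [this]
    linarith
  -- uniform bound on every horizon
  have hunif : ∀ S : ℝ, 0 ≤ S →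
      ∫ x, (forecast (pinnedChain ω₂ lam β γ) N T (Jtot (pinnedChain ω₂ lam β γ) N) S x) ^ 2
          ∂(gibbsW (pinnedChain ω₂ lam β γ) N T) ≤
        (Real.sqrt (max C₁ 0 * (1 + a)) + max C₂ 0) ^ 2 * (N : ℝ) ^ 2 *
          gibbsZ (pinnedChain ω₂ lam β γ) N T := by
    intro S hS
    rcases le_or_gt S (a * N) with hSa | hSa
    · have := hbudget S hS hSa
      have h' : max C₁ 0 * (1 + a) * (N : ℝ) ^ 2 * gibbsZ (pinnedChain ω₂ lam β γ) N T ≤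
          (Real.sqrt (max C₁ 0 * (1 + a)) + max C₂ 0) ^ 2 * (N : ℝ) ^ 2 *
            gibbsZ (pinnedChain ω₂ lam β γ) N T := by
        have : 0 ≤ (N : ℝ) ^ 2 * gibbsZ (pinnedChain ω₂ lam β γ) N T := by positivity
        nlinarith [hDK, this]
      linarith
    · -- S beyond the crossing: split u_S = u_{aN} + (u_S − u_{aN})
      have haN0 : 0 ≤ a * N := mul_nonneg ha.le hN0
      have haNS : a * N ≤ S := hSa.le
      set f := forecast (pinnedChain ω₂ lam β γ) N T (Jtot (pinnedChain ω₂ lam β γ) N) (a * N)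
        with hf_def
      set uS := forecast (pinnedChain ω₂ lam β γ) N T (Jtot (pinnedChain ω₂ lam β γ) N) S
        with huS_def
      set g : PhaseSpace N → ℝ := fun x => uS x - f x with hg_def
      have hfm : MemLp f 2 (gibbsW (pinnedChain ω₂ lam β γ) N T) := hmem (a * N) haN0
      have huSm : MemLp uS 2 (gibbsW (pinnedChain ω₂ lam β γ) N T) := hmem S hS
      have hgm : MemLp g 2 (gibbsW (pinnedChain ω₂ lam β γ) N T) := huSm.sub hfm
      have hsplit : (fun x => uS x) = fun x => f x + g x := by
        funext x; simp [hg_def]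
      -- ‖f‖ ≤ √(D) N √Z
      have hf_le : Real.sqrt (∫ x, f x ^ 2 ∂(gibbsW (pinnedChain ω₂ lam β γ) N T)) ≤
          Real.sqrt (max C₁ 0 * (1 + a)) * N * Real.sqrt (gibbsZ (pinnedChain ω₂ lam β γ) N T) := by
        have h1 := hbudget (a * N) haN0 le_rfl
        have h2 : Real.sqrt (∫ x, f x ^ 2 ∂(gibbsW (pinnedChain ω₂ lam β γ) N T)) ≤
            Real.sqrt (max C₁ 0 * (1 + a) * (N : ℝ) ^ 2 * gibbsZ (pinnedChain ω₂ lam β γ) N T) :=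
          Real.sqrt_le_sqrt h1
        have h3 : Real.sqrt (max C₁ 0 * (1 + a) * (N : ℝ) ^ 2 * gibbsZ (pinnedChain ω₂ lam β γ) N T) =
            Real.sqrt (max C₁ 0 * (1 + a)) * N * Real.sqrt (gibbsZ (pinnedChain ω₂ lam β γ) N T) := by
          rw [Real.sqrt_mul (by positivity), Real.sqrt_mul hD0, Real.sqrt_sq hN0]
        linarith [h2, h3.le, h3.ge]
      -- ‖g‖ ≤ ∫_{(aN,S]} √A ≤ ∫_{(aN,∞)} √A ≤ C₂ N √Z
      have hIoi := (hC₂ N).1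
      have hIoc : IntegrableOn
          (fun t : ℝ => Real.sqrt (OddSectorLocality.forecastNormSq ω₂ lam β γ T N t))
          (Set.Ioc (a * (N : ℝ)) S) := hIoi.mono_set Set.Ioc_subset_Ioi_self
      have hg_le1 : Real.sqrt (∫ x, g x ^ 2 ∂(gibbsW (pinnedChain ω₂ lam β γ) N T)) ≤
          ∫ t in Set.Ioc (a * (N : ℝ)) S,
            Real.sqrt (OddSectorLocality.forecastNormSq ω₂ lam β γ T N t) :=
        (hKK N S hS).2 haNS hIoc
      have hg_le2 : ∫ t in Set.Ioc (a * (N : ℝ)) S,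
            Real.sqrt (OddSectorLocality.forecastNormSq ω₂ lam β γ T N t) ≤
          ∫ t in Set.Ioi (a * (N : ℝ)),
            Real.sqrt (OddSectorLocality.forecastNormSq ω₂ lam β γ T N t) :=
        setIntegral_mono_set hIoi (ae_of_all _ fun t => Real.sqrt_nonneg _)
          (ae_of_all _ Set.Ioc_subset_Ioi_self)
      have hg_le3 : ∫ t in Set.Ioi (a * (N : ℝ)),
            Real.sqrt (OddSectorLocality.forecastNormSq ω₂ lam β γ T N t) ≤
          max C₂ 0 * N * Real.sqrt (gibbsZ (pinnedChain ω₂ lam β γ) N T) := by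
        have h1 := (hC₂ N).2
        have : 0 ≤ (N : ℝ) * Real.sqrt (gibbsZ (pinnedChain ω₂ lam β γ) N T) := by positivity
        nlinarith [h1, hC₂', this]
      have hg_le : Real.sqrt (∫ x, g x ^ 2 ∂(gibbsW (pinnedChain ω₂ lam β γ) N T)) ≤
          max C₂ 0 * N * Real.sqrt (gibbsZ (pinnedChain ω₂ lam β γ) N T) :=
        hg_le1.trans (hg_le2.trans hg_le3)
      -- Minkowski
      have hmink : Real.sqrt (∫ x, uS x ^ 2 ∂(gibbsW (pinnedChain ω₂ lam β γ) N T)) ≤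
          (Real.sqrt (max C₁ 0 * (1 + a)) + max C₂ 0) * N *
            Real.sqrt (gibbsZ (pinnedChain ω₂ lam β γ) N T) := by
        have h1 : Real.sqrt (∫ x, uS x ^ 2 ∂(gibbsW (pinnedChain ω₂ lam β γ) N T)) =
            Real.sqrt (∫ x, (f x + g x) ^ 2 ∂(gibbsW (pinnedChain ω₂ lam β γ) N T)) := by
          congr 1
          refine integral_congr_ae (ae_of_all _ fun x => ?_)
          simp only [hg_def]
          ring
        rw [h1]
        have h2 := sqrt_integral_add_sq_le hfm hgm
        nlinarith [h2, hf_le, hg_le]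
      -- square
      have hsq : ∫ x, uS x ^ 2 ∂(gibbsW (pinnedChain ω₂ lam β γ) N T) =
          Real.sqrt (∫ x, uS x ^ 2 ∂(gibbsW (pinnedChain ω₂ lam β γ) N T)) ^ 2 :=
        (Real.sq_sqrt (integral_nonneg fun _ => sq_nonneg _)).symm
      have hR0 : 0 ≤ (Real.sqrt (max C₁ 0 * (1 + a)) + max C₂ 0) * N *
          Real.sqrt (gibbsZ (pinnedChain ω₂ lam β γ) N T) := by positivity
      have hL0 : 0 ≤ Real.sqrt (∫ x, uS x ^ 2 ∂(gibbsW (pinnedChain ω₂ lam β γ) N T)) :=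
        Real.sqrt_nonneg _
      have h3 : Real.sqrt (∫ x, uS x ^ 2 ∂(gibbsW (pinnedChain ω₂ lam β γ) N T)) ^ 2 ≤
          ((Real.sqrt (max C₁ 0 * (1 + a)) + max C₂ 0) * N *
            Real.sqrt (gibbsZ (pinnedChain ω₂ lam β γ) N T)) ^ 2 :=
        pow_le_pow_left₀ hL0 hmink 2
      have h4 : ((Real.sqrt (max C₁ 0 * (1 + a)) + max C₂ 0) * N *
            Real.sqrt (gibbsZ (pinnedChain ω₂ lam β γ) N T)) ^ 2 =
          (Real.sqrt (max C₁ 0 * (1 + a)) + max C₂ 0) ^ 2 * (N : ℝ) ^ 2 *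
            gibbsZ (pinnedChain ω₂ lam β γ) N T := by
        rw [mul_pow, mul_pow, Real.sq_sqrt hZ0]
      rw [hsq]
      linarith [h3, h4.le]
  -- FATOU along the a.e. limit (through the sequence of integer horizons)
  set μ := gibbsW (pinnedChain ω₂ lam β γ) N T with hμ_def
  set K := (Real.sqrt (max C₁ 0 * (1 + a)) + max C₂ 0) ^ 2 with hK_def
  set Z := gibbsZ (pinnedChain ω₂ lam β γ) N T with hZ_def
  let v : ℕ → PhaseSpace N → ℝ := fun n x =>
    forecast (pinnedChain ω₂ lam β γ) N T (Jtot (pinnedChain ω₂ lam β γ) N) (n : ℝ) x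
  have hv_mem : ∀ n, MemLp (v n) 2 μ := fun n => hmem (n : ℝ) (Nat.cast_nonneg n)
  have hv_tend : ∀ᵐ x ∂μ, Tendsto (fun n : ℕ => v n x) atTop (𝓝 (u x)) :=
    hu.mono fun x hx => hx.comp tendsto_natCast_atTop_atTop
  have hu_meas : AEStronglyMeasurable u μ :=
    aestronglyMeasurable_of_tendsto_ae atTop (fun n => (hv_mem n).1) hv_tend
  have hlim : ∀ᵐ x ∂μ, Tendsto (fun n : ℕ => ENNReal.ofReal ((v n x) ^ 2)) atTop
      (𝓝 (ENNReal.ofReal ((u x) ^ 2))) := by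
    filter_upwards [hv_tend] with x hx
    exact (ENNReal.continuous_ofReal.tendsto _).comp ((hx.pow 2))
  have hliminf_eq : (fun x => ENNReal.ofReal ((u x) ^ 2)) =ᵐ[μ]
      fun x => liminf (fun n : ℕ => ENNReal.ofReal ((v n x) ^ 2)) atTop := by
    filter_upwards [hlim] with x hx
    exact hx.liminf_eq.symm
  have hterm : ∀ n : ℕ, ∫⁻ x, ENNReal.ofReal ((v n x) ^ 2) ∂μ ≤ ENNReal.ofReal (K * (N : ℝ) ^ 2 * Z) := by
    intro n
    have hint : Integrable (fun x => (v n x) ^ 2) μ := (hv_mem n).integrable_sq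
    rw [← ofReal_integral_eq_lintegral_ofReal hint (ae_of_all _ fun x => sq_nonneg _)]
    exact ENNReal.ofReal_le_ofReal (hunif (n : ℝ) (Nat.cast_nonneg n))
  have hlint : ∫⁻ x, ENNReal.ofReal ((u x) ^ 2) ∂μ ≤ ENNReal.ofReal (K * (N : ℝ) ^ 2 * Z) := by
    rw [lintegral_congr_ae hliminf_eq]
    have hmeas : ∀ n : ℕ, AEMeasurable (fun x => ENNReal.ofReal ((v n x) ^ 2)) μ := fun n =>
      ENNReal.measurable_ofReal.comp_aemeasurable (((hv_mem n).1.aemeasurable).pow_const 2)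
    refine (lintegral_liminf_le' hmeas).trans ?_
    refine (liminf_le_limsup).trans ?_
    exact limsup_le_of_le (by isBoundedDefault) (Eventually.of_forall hterm)
  have hu_sq_int : Integrable (fun x => (u x) ^ 2) μ := by
    refine ⟨(hu_meas.aemeasurable.pow_const 2).aestronglyMeasurable, ?_⟩
    rw [hasFiniteIntegral_iff_ofReal (ae_of_all _ fun x => sq_nonneg _)]
    exact lt_of_le_of_lt hlint ENNReal.ofReal_lt_top
  have hu_memLp : MemLp u 2 μ := (memLp_two_iff_integrable_sq hu_meas).2 hu_sq_int
  refine ⟨hu_memLp, ?_⟩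
  have hKZ : 0 ≤ K * (N : ℝ) ^ 2 * Z := by positivity
  rw [integral_eq_lintegral_of_nonneg_ae (ae_of_all _ fun x => sq_nonneg _)
    hu_sq_int.aestronglyMeasurable]
  have := ENNReal.toReal_mono ENNReal.ofReal_ne_top hlint
  rwa [ENNReal.toReal_ofReal hKZ] at this


/-! ## The crux by name -/

/-- **`ConeScaleCorrector_of`**: the registered stubs imply the route decl
`Summit.AtomisticToContinuum.FouriersLaw.Theses.OddSectorIrreversibility.ConeScaleCorrector` BY NAME. -/
theorem ConeScaleCorrector_of :
    Summit.AtomisticToContinuum.FouriersLaw.Theses.OddSectorIrreversibility.ConeScaleCorrector := by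
  rw [coneScaleCorrector_iff_clean]
  intro ω₂ lam β γ hω hl hβ hγ T hTpos
  obtain ⟨a, ha, hTail⟩ := tailAt_of_stub hω hl hβ hγ hTpos
  exact cruxAt_of ha (budgetAt_of_stub hω hl hβ hγ hTpos) hTail (bookAt_of_stub hω hl hβ hγ hTpos ha)

end Summit.AtomisticToContinuum.FouriersLaw.Theorems.OddSectorIrreversibility.InnerCone
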